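/-
COR-CM (cell pub-hodgecm2, stage 2 of the Hodge ladder) — junction B01 `PerLFace_of_PerL`: SECOND-LEVEL SPLIT of the two displayed
inputs of `CorCM/B01/FaceSkeleton.lean` (ROUTES-B01.md v3 §8, routes L1-E / L1-F of the ideation seat pub-hodgecm2-b01-idea-1,
convergent with L2-D / L2-E of pub-hodgecm2-b01-idea-2).  STATEMENTS AND PROOFS AUTHORED by planner-pub-hodgecm2-b01-idea-1-g2-0
(`HOME/b01/IDEA-1b-Sketch.lean`, md5 d6f03ebe7add, farm rc 0 · 0 sorry, 2026-08-21T06:10Z); FILED (this header; the sketch's `HR20pms` def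
inlined as a hypothesis; the `HeckeWedge10` form of the B01 theorem added) by the single owner of B01, prover-pub-hodgecm2-own-b01-0.
Four `@[conjecture]` definitions (displayed face-scoped residuals, finer than B01-L/B01-C), two support definitions, theorems;
nothing cited as a record, nothing asserted; `Interfaces.lean` (C1) and `Assembly/ModelChain*.lean` untouched.

  B01-L  `FaceLineField U`      ⇐  `FaceSupply U` ∧ `HeckeWedge10 U`          (any `U` with `Fact_pull_comp`, `Fact_pull_hodge`)
  B01-C  `FaceSeesawCoupling U` ⇐  `FaceWedgeOverlap U` ∧ HR(2,0) on `U.pms`     (any `U` with the PerL-cone facts; on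
                                                                                   `Model.universeOf` HR(2,0) is a THEOREM)
  B01    `PerLFace_of_PerL`      ⇐  (∀ data, FaceSupply) ∧ (∀ data, HeckeWedge10) ∧ (∀ data, FaceWedgeOverlap)
                                    — `Model.perLFace_of_PerL_of_supply_heckeWedge10_overlap`, through the landed
                                      `perLFace_of_PerL_of_faceInputs`.

`HeckeWedge` / `HeckeWedge10` is the SHAPE, typed over a universe, of T. N. Venkataramana, *Cohomology of compact locally
symmetric spaces*, Compositio Math. 125 (2001), Theorem 8 p. 229 (`G_ℝ = SU(n,1)` up to compact factors, `a, a′` non-zero classes of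
degrees `k + k′ ≤ n` ⇒ `∃ g ∈ G_f, g(a) ∧ a′ ≠ 0`; here `n = 2`, `k = k′ = 1`; holomorphic case: L. Clozel, J. reine angew. Math.
444 (1993) 1–15) — i.e. PerL v5 Prop 4.3's density argument is a published theorem on congruence towers of compact ball quotients,
blind to theta lifting; its U_rec instance is owed as a CITE row + junction (Hecke translations as `U.Mor` over
`UnitaryBallLevelCovering.exists_hom_map_unif_eq`), not as manuscript mathematics.  `FaceWedgeOverlap` is the finite-level shadow
of PerL v5 Thm 3.7 (`S₁₂ = S₃₄`, tex ll. 447–458) with Lemma 3.5 (ll. 350–353): an intersection of two `Submodule ℂ` spans in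
`H²(P_{Γ′}, ℂ)`; Petersson = period and the Hodge–Riemann reading are KERNEL here (`period_eq_pairing_wedges`,
`Model.universeOf_hodgeRiemann_pms`, landed in `CorCM/B01/HodgeRiemannPeriod.lean`).
-/
import Summits.HodgeConjecture.CorCM.B01.HodgeRiemannPeriod
import Summits.HodgeConjecture.CorCM.B01.FaceSkeleton
import HarnessLib

noncomputable section

open scoped TensorProduct

namespace Summit.HodgeConjecture.CorCM

open Literature.AlgebraicGeometry.Motives (CMType HodgeStructure)
open Literature.AlgebraicGeometry.Motives.HodgeStructure (EndAction conj)

namespace Universe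

variable (U : Universe)

/-! ## §A  B01-L from supply and the Hecke-translate wedge -/

/-- **FaceSupply** (the existence half of B01-L; stage-1 `hΘ` kind): for every face datum `(F, f, ι₁, V)` there is ONE
level `Γ` carrying a non-zero class of `U_{Ψ₀}(Γ)` and a non-zero class of `U_{Ψ₁}(Γ)` (non-vanishing theta lifts of the
two CM types `Ψ₀ = f.psi 0`, `Ψ₁ = f.psi 1`; no condition on their wedge).  Displayed hypothesis; not asserted. -/
@[conjecture]
def FaceSupply : Prop :=
  ∀ (F : CMField), IsGalois ℚ F → 6 ≤ Module.finrank ℚ F →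
    ∀ (f : Face F) (ι₁ : F →+* ℂ), f.Admissible ι₁ →
    ∀ V : HermSpace3 F ι₁, ∃ (Γ : Level V) (ω₀ ω₁ : U.CohC (U.pms F ι₁ V Γ) 1),
      ω₀ ∈ U.Uiso Γ F (f.psi 0) ι₁ ∧ ω₁ ∈ U.Uiso Γ F (f.psi 1) ι₁ ∧ ω₀ ≠ 0 ∧ ω₁ ≠ 0

/-- **HeckeWedge** — Venkataramana 2001 Theorem 8 for `SU(2,1)`, degrees `1 + 1 ≤ 2`, typed over a universe: two non-zero
degree-one classes `a, a'` on a Picard modular surface `P_Γ` acquire a non-zero cup product after pulling back along two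
morphisms of surfaces `g, h : P_{Γ'} → P_Γ` of the tower (in print: `h` the level covering, `g` a Hecke translation
`z ↦ γz`, `γ ∈ U(V)(F₀)`; the universe form only asks for SOME `Γ', g, h`, which is weaker).  Displayed hypothesis. -/
@[conjecture]
def HeckeWedge : Prop :=
  ∀ (L : CMField) (ι₁ : L →+* ℂ) (V : HermSpace3 L ι₁) (Γ : Level V) (a a' : U.CohC (U.pms L ι₁ V Γ) 1),
    a ≠ 0 → a' ≠ 0 →
      ∃ (Γ' : Level V) (g h : U.Mor (U.pms L ι₁ V Γ') (U.pms L ι₁ V Γ)),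
        U.cup2C (U.pms L ι₁ V Γ') 1 (U.pullC g 1 a) (U.pullC h 1 a') ≠ 0

variable {U}

/-- **B01-L from supply and the Hecke-translate wedge.**  `U_Ψ(Γ)` is stable under pull-back along every morphism of
surfaces (`pullC_mem_Uiso`, `Fact_pull_comp` only), so the two pulled-back classes of `HeckeWedge` are again in
`U_{Ψ₀}(Γ')`, `U_{Ψ₁}(Γ')` and witness `FaceLineField` at level `Γ'`. -/
theorem faceLineField_of_supply_of_heckeWedge (hc : U.Fact_pull_comp) (hS : U.FaceSupply) (hW : U.HeckeWedge) :
    U.FaceLineField := by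
  intro F hG h6 f ι₁ hι V
  obtain ⟨Γ, ω₀, ω₁, h₀, h₁, hne₀, hne₁⟩ := hS F hG h6 f ι₁ hι V
  obtain ⟨Γ', g, h, hne⟩ := hW F ι₁ V Γ ω₀ ω₁ hne₀ hne₁
  exact ⟨Γ', U.pullC g 1 ω₀, U.pullC h 1 ω₁, pullC_mem_Uiso hc g F (f.psi 0) ι₁ h₀,
    pullC_mem_Uiso hc h F (f.psi 1) ι₁ h₁, hne⟩

/-! ## §B  B01-C from the Hecke-overlap of wedge spans and Hodge–Riemann -/

variable (U)

/-- `W₃₄(Γ')`: the span of the (34)-wedges `ω₂ ∪ ω₃`, `ω₂ ∈ U_{Ψ₂}(Γ')`, `ω₃ ∈ U_{Ψ₃}(Γ')` (PerL's `S₃₄` read on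
`H²(P_{Γ'}, ℂ)`; generation by pure wedges is by DEFINITION here, so PerL Lemma 3.5 is not an input). -/
def wedgeSpan {L : CMField} {ι₁ : L →+* ℂ} {V : HermSpace3 L ι₁} (Γ' : Level V) (K : CMField) (Ψ Ψ' : CMType K)
    (σ : K →+* ℂ) : Submodule ℂ (U.CohC (U.pms L ι₁ V Γ') 2) :=
  Submodule.span ℂ {x | ∃ ω₂ ω₃ : U.CohC (U.pms L ι₁ V Γ') 1,
    ω₂ ∈ U.Uiso Γ' K Ψ σ ∧ ω₃ ∈ U.Uiso Γ' K Ψ' σ ∧ x = U.cup2C (U.pms L ι₁ V Γ') 1 ω₂ ω₃}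

/-- `E₁₂(Γ'; x)`: the span of the pull-backs `g^*x` of one degree-two class `x ∈ H²(P_Γ, ℂ)` along ALL morphisms
`g : P_{Γ'} → P_Γ` (in the model: the Hecke ∘ covering translates of the (12)-wedge `x = ω₀ ∪ ω₁`). -/
def heckeSpan {L : CMField} {ι₁ : L →+* ℂ} {V : HermSpace3 L ι₁} (Γ' Γ : Level V)
    (x : U.CohC (U.pms L ι₁ V Γ) 2) : Submodule ℂ (U.CohC (U.pms L ι₁ V Γ') 2) :=
  Submodule.span ℂ {y | ∃ g : U.Mor (U.pms L ι₁ V Γ') (U.pms L ι₁ V Γ), y = U.pullC g 2 x}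

/-- **FaceWedgeOverlap** (cohomological shadow of PerL Thm 3.7 `S₁₂ = S₃₄`, face-transposed): for every face datum, every
level `Γ` and every non-zero (12)-wedge `ω₀ ∪ ω₁` of `U_Ψ`-classes, at some level `Γ'` the span of its translates
`g^*(ω₀ ∪ ω₁)` meets the span `W₃₄(Γ')` of (34)-wedges non-trivially.  Displayed hypothesis; not asserted. -/
@[conjecture]
def FaceWedgeOverlap : Prop :=
  ∀ (F : CMField), IsGalois ℚ F → 6 ≤ Module.finrank ℚ F →
    ∀ (f : Face F) (ι₁ : F →+* ℂ), f.Admissible ι₁ →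
    ∀ (V : HermSpace3 F ι₁) (Γ : Level V) (ω₀ ω₁ : U.CohC (U.pms F ι₁ V Γ) 1),
      ω₀ ∈ U.Uiso Γ F (f.psi 0) ι₁ → ω₁ ∈ U.Uiso Γ F (f.psi 1) ι₁ →
      U.cup2C (U.pms F ι₁ V Γ) 1 ω₀ ω₁ ≠ 0 →
        ∃ (Γ' : Level V) (x : U.CohC (U.pms F ι₁ V Γ') 2), x ≠ 0 ∧
          x ∈ U.heckeSpan Γ' Γ (U.cup2C (U.pms F ι₁ V Γ) 1 ω₀ ω₁) ∧
          x ∈ U.wedgeSpan Γ' F (f.psi 2) (f.psi 3) ι₁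

variable {U}

/-- The sesquilinear pairing `⟨y, z⟩ := tr(y ∪ conj z)` on `H²(P, ℂ)`: additive and conjugate-homogeneous in `z`. -/
private theorem pairing_conj_add (X : U.Var) (y z z' : U.CohC X 2) :
    U.trC X 4 (U.cup2C X 2 y (conj (z + z'))) =
      U.trC X 4 (U.cup2C X 2 y (conj z)) + U.trC X 4 (U.cup2C X 2 y (conj z')) := by
  rw [map_add, map_add, map_add]

/-- The pairing `⟨y, z⟩ := tr(y ∪ conj z)` is conjugate-homogeneous in `z`. [folklore] -/
private theorem pairing_conj_smul (X : U.Var) (y z : U.CohC X 2) (c : ℂ) :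
    U.trC X 4 (U.cup2C X 2 y (conj (c • z))) = starRingEnd ℂ c * U.trC X 4 (U.cup2C X 2 y (conj z)) := by
  rw [HodgeStructure.conj_smul, map_smul, map_smul, smul_eq_mul]

/-- **B01-C from the Hecke-overlap and Hodge–Riemann** (any universe with the four PerL-cone facts and HR (2,0) on its
Picard modular surfaces).  Proof: the overlap class `x ≠ 0` lies in `F²H²` (it is a combination of (34)-wedges of
`U_Ψ`-classes), so `tr(x ∪ conj x) ≠ 0` (HR); expanding `x` on the left over the translates `g^*(ω₀ ∪ ω₁) = g^*ω₀ ∪ g^*ω₁`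
(`Fact_pull_cup`) and then `conj x` on the right over the pure (34)-wedges (`exists_mem_ne_zero_of_span`, twice) yields
`g, ω₂, ω₃` with `tr((g^*ω₀ ∪ g^*ω₁) ∪ conj(ω₂ ∪ ω₃)) ≠ 0`, which is the period (`period_eq_pairing_wedges`). -/
theorem faceSeesawCoupling_of_wedgeOverlap (hH : U.Fact_pull_hodge) (hcup2 : U.Fact_cup2_hodge)
    (hpc : U.Fact_pull_cup)
    (hHR : ∀ {L : CMField} {ι₁ : L →+* ℂ} {V : HermSpace3 L ι₁} (Γ : Level V) (η : U.CohC (U.pms L ι₁ V Γ) 2),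
      η ∈ (U.hodge (U.pms L ι₁ V Γ) 2).F 2 → η ≠ 0 → U.trC (U.pms L ι₁ V Γ) 4 (U.cup2C (U.pms L ι₁ V Γ) 2 η (conj η)) ≠ 0)
    (hO : U.FaceWedgeOverlap) : U.FaceSeesawCoupling := by
  intro F hG h6 f ι₁ hι V Γ ω₀ ω₁ h₀ h₁ hne
  obtain ⟨Γ', x, hx0, hxE, hxW⟩ := hO F hG h6 f ι₁ hι V Γ ω₀ ω₁ h₀ h₁ hne
  -- `x ∈ F² H²(P_{Γ'})`: every (34)-wedge of `U_Ψ`-classes is a (2,0)-class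
  have hxF : x ∈ (U.hodge (U.pms F ι₁ V Γ') 2).F 2 := by
    refine (Submodule.span_le.mpr ?_) hxW
    rintro y ⟨ω₂, ω₃, h₂, h₃, rfl⟩
    exact cup2C_mem_F_two_of_Uiso hH hcup2 Γ' F (f.psi 2) (f.psi 3) ι₁ h₂ h₃
  -- Hodge–Riemann: `⟨x, x⟩ ≠ 0`
  have hxx : U.trC _ 4 (U.cup2C _ 2 x (conj x)) ≠ 0 := hHR Γ' x hxF hx0
  -- expand the LEFT slot over the translates `g^* (ω₀ ∪ ω₁)` (the pairing is ℂ-linear in the left slot)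
  obtain ⟨y, ⟨g, rfl⟩, hy⟩ := exists_mem_ne_zero_of_span (φ := fun y => U.trC _ 4 (U.cup2C _ 2 y (conj x)))
    (fun y y' => by simp only [map_add, LinearMap.add_apply])
    (fun c y => ⟨c, by simp only [map_smul, LinearMap.smul_apply, smul_eq_mul]⟩) hxE hxx
  -- expand the RIGHT slot over the pure (34)-wedges (the pairing is conjugate-linear in the right slot)
  obtain ⟨z, ⟨ω₂, ω₃, h₂, h₃, rfl⟩, hz⟩ :=
    exists_mem_ne_zero_of_span (φ := fun z => U.trC _ 4 (U.cup2C _ 2 (U.pullC g 2 (U.cup2C _ 1 ω₀ ω₁)) (conj z)))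
      (fun z z' => pairing_conj_add _ _ z z') (fun c z => ⟨starRingEnd ℂ c, pairing_conj_smul _ _ z c⟩) hxW hy
  refine ⟨Γ', g, ω₂, ω₃, h₂, h₃, ?_⟩
  rw [period_eq_pairing_wedges]
  simp only [Matrix.cons_val_zero, Matrix.cons_val_one, Matrix.cons_val]
  have hg : U.pullC g 2 (U.cup2C (U.pms F ι₁ V Γ) 1 ω₀ ω₁) =
      U.cup2C (U.pms F ι₁ V Γ') 1 (U.pullC g 1 ω₀) (U.pullC g 1 ω₁) := pullC_cup2C hpc g 1 ω₀ ω₁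
  rw [hg] at hz
  exact hz

/-- **The face-form period theorem from the three cheaper inputs** (supply, Hecke wedge, wedge overlap) and HR. -/
theorem periodThmF_of_supply_heckeWedge_overlap (hc : U.Fact_pull_comp) (hH : U.Fact_pull_hodge)
    (hcup2 : U.Fact_cup2_hodge) (hpc : U.Fact_pull_cup)
    (hHR : ∀ {L : CMField} {ι₁ : L →+* ℂ} {V : HermSpace3 L ι₁} (Γ : Level V) (η : U.CohC (U.pms L ι₁ V Γ) 2),
      η ∈ (U.hodge (U.pms L ι₁ V Γ) 2).F 2 → η ≠ 0 → U.trC (U.pms L ι₁ V Γ) 4 (U.cup2C (U.pms L ι₁ V Γ) 2 η (conj η)) ≠ 0)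
    (hS : U.FaceSupply) (hW : U.HeckeWedge) (hO : U.FaceWedgeOverlap) : U.PeriodThmF :=
  periodThmF_of_faceInputs hc (faceLineField_of_supply_of_heckeWedge hc hS hW)
    (faceSeesawCoupling_of_wedgeOverlap hH hcup2 hpc hHR hO)

/-! ## §D  The holomorphic-only wedge input (what the elementary CdF proof plan delivers) -/

variable (U)

/-- **HeckeWedge10** — `HeckeWedge` asked only for non-zero classes of bidegree (1,0) (`piece 1 0`): the holomorphic case
(Clozel 1993; Venkataramana 2001 Thm 8, Remark), and exactly what the elementary proof plan of IDEA-1b §L1-E′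
(Castelnuovo–de Franchis + fibration uniqueness + Hecke translations + real approximation + isotropy) proves on the model.
Displayed hypothesis; not asserted. -/
@[conjecture]
def HeckeWedge10 : Prop :=
  ∀ (L : CMField) (ι₁ : L →+* ℂ) (V : HermSpace3 L ι₁) (Γ : Level V) (a a' : U.CohC (U.pms L ι₁ V Γ) 1),
    a ∈ (U.hodge (U.pms L ι₁ V Γ) 1).piece 1 0 → a' ∈ (U.hodge (U.pms L ι₁ V Γ) 1).piece 1 0 → a ≠ 0 → a' ≠ 0 →
      ∃ (Γ' : Level V) (g h : U.Mor (U.pms L ι₁ V Γ') (U.pms L ι₁ V Γ)),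
        U.cup2C (U.pms L ι₁ V Γ') 1 (U.pullC g 1 a) (U.pullC h 1 a') ≠ 0

variable {U}

/-- `HeckeWedge → HeckeWedge10` (monotonicity). -/
theorem heckeWedge10_of_heckeWedge (hW : U.HeckeWedge) : U.HeckeWedge10 :=
  fun L ι₁ V Γ a a' _ _ ha ha' => hW L ι₁ V Γ a a' ha ha'

/-- **B01-L from supply and the holomorphic Hecke wedge** (`U_Ψ(Γ) ⊆ H^{1,0}`: `Uiso_le_piece10`, `Fact_pull_hodge`). -/
theorem faceLineField_of_supply_of_heckeWedge10 (hc : U.Fact_pull_comp) (hH : U.Fact_pull_hodge)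
    (hS : U.FaceSupply) (hW : U.HeckeWedge10) : U.FaceLineField := by
  intro F hG h6 f ι₁ hι V
  obtain ⟨Γ, ω₀, ω₁, h₀, h₁, hne₀, hne₁⟩ := hS F hG h6 f ι₁ hι V
  obtain ⟨Γ', g, h, hne⟩ := hW F ι₁ V Γ ω₀ ω₁ (Uiso_le_piece10 hH Γ F (f.psi 0) ι₁ h₀)
    (Uiso_le_piece10 hH Γ F (f.psi 1) ι₁ h₁) hne₀ hne₁
  exact ⟨Γ', U.pullC g 1 ω₀, U.pullC h 1 ω₁, pullC_mem_Uiso hc g F (f.psi 0) ι₁ h₀,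
    pullC_mem_Uiso hc h F (f.psi 1) ι₁ h₁, hne⟩

end Universe

/-! ## §C  The model universe: HR is a theorem, so B01 ⇐ FaceSupply ∧ HeckeWedge ∧ FaceWedgeOverlap -/

namespace Model

open Literature.NumberTheory.Automorphic
open Literature.NumberTheory.Automorphic.PicardCM
open Literature.AlgebraicGeometry.HodgeTheory

/-- **B01-C of the model universe from `FaceWedgeOverlap` alone** (all facts and HR are tree theorems). -/
theorem universeOf_faceSeesawCoupling_of_wedgeOverlap (hHD : exists_isReal_hodgeModel)
    (hI : hodgePQ_independent_of_hodgeModel) (hU : BallQuotientUniformisedDatum) (h₃ : CMAbelianVarietyRealised)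
    (hO : (universeOf hHD hI hU h₃).FaceWedgeOverlap) : (universeOf hHD hI hU h₃).FaceSeesawCoupling :=
  Universe.faceSeesawCoupling_of_wedgeOverlap (universeOf_fact_pull_hodge hHD hI hU h₃)
    (universeOf_fact_cup2_hodge hHD hI hU h₃) (universeOf_fact_pull_cup hHD hI hU h₃)
    (fun Γ η hη h0 => universeOf_hodgeRiemann_pms hHD hI hU h₃ _ Γ η hη h0) hO

/-- **Binder B01 BY NAME from the three cheaper inputs** demanded at every instance of the model universe of B01
(`Model.picardCMUniverse hHD hI h₁ h₃ = universeOf hHD hI (ballQuotientUniformisedDatum_of h₁) h₃`); `U.PerL` idle. -/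
theorem perLFace_of_PerL_of_supply_heckeWedge_overlap
    (hS : ∀ (hHD : exists_isReal_hodgeModel) (hI : hodgePQ_independent_of_hodgeModel)
      (h₁ : BallQuotientUniformised) (h₃ : CMAbelianVarietyRealised), (picardCMUniverse hHD hI h₁ h₃).FaceSupply)
    (hW : ∀ (hHD : exists_isReal_hodgeModel) (hI : hodgePQ_independent_of_hodgeModel)
      (h₁ : BallQuotientUniformised) (h₃ : CMAbelianVarietyRealised), (picardCMUniverse hHD hI h₁ h₃).HeckeWedge)
    (hO : ∀ (hHD : exists_isReal_hodgeModel) (hI : hodgePQ_independent_of_hodgeModel)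
      (h₁ : BallQuotientUniformised) (h₃ : CMAbelianVarietyRealised), (picardCMUniverse hHD hI h₁ h₃).FaceWedgeOverlap) :
    PerLFace_of_PerL :=
  perLFace_of_PerL_of_faceInputs
    (fun hHD hI h₁ h₃ => Universe.faceLineField_of_supply_of_heckeWedge
      (universeOf_fact_pull_comp hHD hI (ballQuotientUniformisedDatum_of h₁) h₃) (hS hHD hI h₁ h₃) (hW hHD hI h₁ h₃))
    (fun hHD hI h₁ h₃ => universeOf_faceSeesawCoupling_of_wedgeOverlap hHD hI (ballQuotientUniformisedDatum_of h₁) h₃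
      (hO hHD hI h₁ h₃))

/-- **Binder B01 BY NAME from supply, the HOLOMORPHIC Hecke wedge and the wedge overlap** — the form of record of this
split (the weakest displayed wedge input: `HeckeWedge10`, classes of bidegree (1,0) only; `U_Ψ ⊆ H^{1,0}` by
`Universe.Uiso_le_piece10`).  `U.PerL` idle. [folklore] -/
theorem perLFace_of_PerL_of_supply_heckeWedge10_overlap
    (hS : ∀ (hHD : exists_isReal_hodgeModel) (hI : hodgePQ_independent_of_hodgeModel)
      (h₁ : BallQuotientUniformised) (h₃ : CMAbelianVarietyRealised), (picardCMUniverse hHD hI h₁ h₃).FaceSupply)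
    (hW : ∀ (hHD : exists_isReal_hodgeModel) (hI : hodgePQ_independent_of_hodgeModel)
      (h₁ : BallQuotientUniformised) (h₃ : CMAbelianVarietyRealised), (picardCMUniverse hHD hI h₁ h₃).HeckeWedge10)
    (hO : ∀ (hHD : exists_isReal_hodgeModel) (hI : hodgePQ_independent_of_hodgeModel)
      (h₁ : BallQuotientUniformised) (h₃ : CMAbelianVarietyRealised), (picardCMUniverse hHD hI h₁ h₃).FaceWedgeOverlap) :
    PerLFace_of_PerL :=
  perLFace_of_PerL_of_faceInputs
    (fun hHD hI h₁ h₃ => Universe.faceLineField_of_supply_of_heckeWedge10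
      (universeOf_fact_pull_comp hHD hI (ballQuotientUniformisedDatum_of h₁) h₃)
      (universeOf_fact_pull_hodge hHD hI (ballQuotientUniformisedDatum_of h₁) h₃) (hS hHD hI h₁ h₃) (hW hHD hI h₁ h₃))
    (fun hHD hI h₁ h₃ => universeOf_faceSeesawCoupling_of_wedgeOverlap hHD hI (ballQuotientUniformisedDatum_of h₁) h₃
      (hO hHD hI h₁ h₃))

/-- The closed instance: on the model universe OF RECORD the three inputs give `PerLFace` (= F3's hypothesis). [folklore] -/
theorem perLFace_closed_of_supply_heckeWedge10_overlap
    (hS : (picardCMUniverse exists_isReal_hodgeModel_holds hodgePQ_independent_of_hodgeModel_holds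
      BallQuotient.ballQuotientUniformised_holds cmAbelianVarietyRealised_holds).FaceSupply)
    (hW : (picardCMUniverse exists_isReal_hodgeModel_holds hodgePQ_independent_of_hodgeModel_holds
      BallQuotient.ballQuotientUniformised_holds cmAbelianVarietyRealised_holds).HeckeWedge10)
    (hO : (picardCMUniverse exists_isReal_hodgeModel_holds hodgePQ_independent_of_hodgeModel_holds
      BallQuotient.ballQuotientUniformised_holds cmAbelianVarietyRealised_holds).FaceWedgeOverlap) :
    (picardCMUniverse exists_isReal_hodgeModel_holds hodgePQ_independent_of_hodgeModel_holds
      BallQuotient.ballQuotientUniformised_holds cmAbelianVarietyRealised_holds).PerLFace :=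
  perLFace_of_faceInputs _ _ _ _
    (Universe.faceLineField_of_supply_of_heckeWedge10 (universeOf_fact_pull_comp _ _ _ _)
      (universeOf_fact_pull_hodge _ _ _ _) hS hW)
    (universeOf_faceSeesawCoupling_of_wedgeOverlap _ _ _ _ hO)

end Model

end Summit.HodgeConjecture.CorCM

end
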